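import Mathlib
import HarnessLib

/-!
# Enflo 2023, v2 pp.14–15: the first-order rule for the inverse and the invertibility of `I + VV*`

Source under adjudication: Per H. Enflo, *On the invariant subspace problem in Hilbert spaces*, arXiv:2305.15442 (v1
2023, v2 2024), bib key `Enflo2023` — a CLAIMED proof of the invariant subspace problem for operators on a separable
Hilbert space.  This file is part of the kernel-tight typing of the manuscript by the b2b-enflo repair cell
(formaliser 2, Part B: (28)–(47), the limiting argument and the final deduction).  It records what FOLLOWS (proved
implications from the manuscript's displayed hypotheses) and, where a step does not follow, the typed inference
together with its refutation.  NOTHING here asserts that the manuscript's main theorem holds; no declaration concludes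
the invariant subspace problem for an arbitrary operator.  Value (BLOCK-2b): theorems / refutations of typed
inferences about a text — not progress on the problem.

EnfloISP — Part B (formaliser 2).  v2 pp.14–15: the FIRST-ORDER CALCULUS behind (28)–(30″) and the "ch" of MC:
"If A is an invertible operator the first order change of A⁻¹ when we make the change A → A + B is
A⁻¹ → A⁻¹ − A⁻¹ B A⁻¹"; applied to A = I + V_y V_y^* (= [ ]) and the functional S ↦ ⟨S x₀, x₀⟩ it gives the
first-order change of ⟨[ ]⁻¹x₀, x₀⟩, i.e. (28) once B = α V_{T^j y}V_y^* + ᾱ V_y V^*_{T^j y} is inserted.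
Typed and CLOSED here at the operator-algebra level (Mathlib `hasFDerivAt_ringInverse`): the rule is an exact
Fréchet-derivative statement in the Banach algebra `H →L[ℂ] H`.  The coefficient form (28)
(−Σ_m (α a_m \overline{a_{m+j}} + ᾱ a_{m+j} \overline{a_m}), a_m = ⟨[ ]⁻¹x₀, T^m y⟩) then follows from the Part-A
identities V_{T^j y}V_y^* x = Σ_m ⟨x, T^m y⟩ T^{m+j} y and [ ]⁻¹ self-adjoint; that bookkeeping is verified by
hand in STEPS.md (rows B-28 … B-30″; typos recorded there: g = Σ b_m e^{imθ}, the j = 0 term of (30)).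
Typed in the sibling module Type2Threshold.lean: the THRESHOLD LEMMA behind "there exists L₀ > 0 such that …" of v2 p.20 (type 2), in the
form that actually follows (L₀ := inf of the failure set; the paper's "if L > L₀ there is no such M" for ALL
L > L₀ would need a monotonicity in L that is not argued — STEPS.md row B-T2-1), which is all (47) uses.
STATUS: CLOSED (zero sorry).
-/

open scoped InnerProductSpace
open Filter Topology

namespace Literature.Analysis.OperatorTheory.Enflo2023

variable {H : Type*} [NormedAddCommGroup H] [InnerProductSpace ℂ H] [CompleteSpace H]

/-- v2 p.14: the first-order change of `A⁻¹` under `A → A + B` is `−A⁻¹ B A⁻¹` — as the Fréchet derivative of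
`Ring.inverse` on the Banach algebra `H →L[ℂ] H` at the unit `A`, evaluated in the direction `B`. [cite: Enflo2023, v2 p.14–15] -/
theorem firstOrder_inverse (A : (H →L[ℂ] H)ˣ) (B : H →L[ℂ] H) :
    HasFDerivAt (Ring.inverse : (H →L[ℂ] H) → (H →L[ℂ] H))
      (-ContinuousLinearMap.mulLeftRight ℂ (H →L[ℂ] H) ↑A⁻¹ ↑A⁻¹) (A : H →L[ℂ] H) ∧
    (-ContinuousLinearMap.mulLeftRight ℂ (H →L[ℂ] H) ↑A⁻¹ ↑A⁻¹) B = -(↑A⁻¹ * B * ↑A⁻¹) := by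
  refine ⟨hasFDerivAt_ringInverse A, ?_⟩
  simp [ContinuousLinearMap.mulLeftRight_apply]

/-- The functional `S ↦ ⟨S x₀, x₀⟩` (Mathlib `⟪x₀, S x₀⟫`) on `H →L[ℂ] H` as a continuous linear map. [folklore] -/
noncomputable def evalFunctional (x₀ : H) : (H →L[ℂ] H) →L[ℂ] ℂ :=
  (innerSL ℂ x₀).comp (ContinuousLinearMap.apply ℂ H x₀)

omit [CompleteSpace H] in
/-- Evaluation of `evalFunctional x₀` at an operator `S` is `⟪x₀, S x₀⟫`. [folklore] -/
@[simp] lemma evalFunctional_apply (x₀ : H) (S : H →L[ℂ] H) : evalFunctional x₀ S = ⟪x₀, S x₀⟫_ℂ := rfl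

/-- v2 p.15 (the display before (28)): the first-order change of `⟨[ ]⁻¹x₀, x₀⟩` under `[ ] → [ ] + B` is
`−⟨[ ]⁻¹ B [ ]⁻¹ x₀, x₀⟩`.  Precisely: the map `S ↦ ⟪x₀, S⁻¹ x₀⟫` has Fréchet derivative at the unit `A`
whose value on `B` is `−⟪x₀, A⁻¹ (B (A⁻¹ x₀))⟫`. [cite: Enflo2023, v2 p.14–15] -/
theorem firstOrder_inner_inverse (A : (H →L[ℂ] H)ˣ) (x₀ : H) :
    ∃ D : (H →L[ℂ] H) →L[ℂ] ℂ,
      HasFDerivAt (fun S : H →L[ℂ] H => ⟪x₀, (Ring.inverse S) x₀⟫_ℂ) D (A : H →L[ℂ] H) ∧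
      ∀ B : H →L[ℂ] H, D B = -⟪x₀, (↑A⁻¹ : H →L[ℂ] H) (B ((↑A⁻¹ : H →L[ℂ] H) x₀))⟫_ℂ := by
  refine ⟨(evalFunctional x₀).comp (-ContinuousLinearMap.mulLeftRight ℂ (H →L[ℂ] H) ↑A⁻¹ ↑A⁻¹), ?_, ?_⟩
  · have h := (evalFunctional x₀).hasFDerivAt.comp (A : H →L[ℂ] H) (hasFDerivAt_ringInverse A)
    simpa [Function.comp_def] using h
  · intro B
    simp [ContinuousLinearMap.mulLeftRight_apply]

/-- `[ ] = I + P` with `P` a positive operator (P = V_y V_y^*, v2 p.6: "V_yV_y^* is a compact, self-adjoint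
operator for which ⟨x, V_yV_y^* x⟩ ≥ 0 ∀ x") is invertible — the standing fact that makes `[ ]⁻¹` of (15)
meaningful.  Via the order structure on the C⋆-algebra `H →L[ℂ] H`: `1 ≤ 1 + P` and `1` is strictly positive. [folklore] -/
theorem isUnit_one_add_of_isPositive (P : H →L[ℂ] H) (hP : P.IsPositive) : IsUnit (1 + P) := by
  have h1 : (1 : H →L[ℂ] H) ≤ 1 + P := by
    rw [ContinuousLinearMap.le_def]; simpa using hP
  exact CStarAlgebra.isUnit_of_le 1 h1

end Literature.Analysis.OperatorTheory.Enflo2023
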